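import Literature.Probability.Percolation.SiteInterfaceWindingAllPoints
import Literature.Probability.Percolation.SiteInterfaceStructure
import Literature.Probability.Percolation.LoopTraversalBound
import Literature.Probability.Percolation.CLE6
import Literature.Topology.PlaneTopology.JordanNesting
import HarnessLib

/-!
# Interiors of honeycomb interface loops: the drawn loop is a Jordan curve; nested-or-disjoint

Crux `Summit.CriticalPhenomena.CardyFormulaZ2.Theses.CardyMagicRigidity.NestingRigidity`
(stmt-CriticalPhenomena-4835), line `markov-cascade-one-generation`, helper toward the registered stub
`stub_oneGenerationT : OneGenerationT` (S2, the exact one-generation factorisation of the nesting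
transform on site-`𝕋`).  The statement `OneGenerationT` measures interiors of honeycomb interface
loops by the winding number of the drawn loop `siteLoopCurve δ γ` (`CLE6.lean`: the class of the
dyadic polyline `SimpleGraph.Walk.toCurve` through the rescaled face centres).  This file supplies the
planar topology of these interiors:

* §1 `wind_siteLoopCurve_eq_loopWind` — off the trace, the winding number of `siteLoopCurve δ w` IS the
  winding number `loopWind δ w` of `SiteInterfaceWinding.lean` (the other dyadic bracketing
  `loopPath = polySubPath`), so that the jump / transport calculus of that file applies: both equal
  `(2πi)⁻¹ Σ_k argInc (k-th dart piece)` (`Path.argInc_trans`);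
* §2 `wind_siteLoopCurve_triMeshPoint` — scale invariance `W_δ(δ x) = W_1(x)` (`Curve.wind_map_affine`);
* §3 `JL⟦δ, w⟧` (local notation) — the polygon of a CYCLE of the hexagonal lattice re-timed to drop the constant
  dyadic tail (`toCurve_injOn_of_isCycle`, `HexLatticeSegments.lean`) is a Jordan loop
  (`isJordanLoop_hexJordanLoop`) with the same trace and the same winding numbers (free homotopy
  through time rescalings, `wind_eq_of_homotopy`), whence its inside is `{z | W(siteLoopCurve δ w, z) ≠ 0}`
  (`inside_hexJordanLoop_eq`, Jordan curve theorem of the tree through `IsJordanLoop.mem_inside_iff_wind_ne_zero`);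
* §4 `interior_trichotomy` (registered helper) — **the winding interiors of two interface loops of ONE site
  configuration are nested or disjoint**: their traces are equal or disjoint
  (`IsSiteInterfaceLoop.polyTrace_eq_or_disjoint`) and disjoint Jordan curves are nested or mutually
  exterior (`IsJordanLoop.trichotomy`, `JordanNesting.lean`).
-/

noncomputable section

open Set Metric Complex Filter
open scoped Topology Real

namespace Summit.CriticalPhenomena.CardyFormulaZ2.Cruxes.NestingRigidity.MarkovCascadeOneGeneration

open Literature.Probability.RandomPlanarGeometry Literature.Probability.Percolation
  Literature.Probability.LatticeModels Literature.Topology.PlaneTopology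

/-! ## §1 The two dyadic parametrisations of the polygon wind equally -/

section ArgInc

/-- `Path.argInc_eq_wind_mul` for a path whose endpoints are only propositionally equal. -/
theorem argInc_eq_wind_mul_of_eq {x y : ℂ} (γ : Path x y) (hxy : y = x) {p : ℂ} (hp : p ∉ range γ) :
    γ.argInc p = (wind fun t ↦ γ.extend t - p) * (2 * π * Complex.I) := by
  subst hxy
  exact γ.argInc_eq_wind_mul hp

/-- **The argument increment of the polyline through `p 0, …, p n` about a point off its segments is
the sum of the increments of its segments** (`Path.argInc_trans` along the recursion of
`polylineFrom`; the final `Path.refl` contributes `0`). -/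
theorem argInc_polylineFrom_ptsList :
    ∀ (p : ℕ → ℂ) (n : ℕ) {z : ℂ}, (∀ k < n, z ∉ segment ℝ (p k) (p (k + 1))) →
      ((polylineFrom (p 0) (ptsList p n)).2).argInc z =
        ∑ k ∈ Finset.range n, (Path.segment (p k) (p (k + 1))).argInc z
  | p, 0, z, _ => by simp [ptsList, Path.argInc_refl]
  | p, n + 1, z, hz => by
    change ((Path.segment (p 0) (p 1)).trans
      (polylineFrom (p 1) (ptsList (fun k ↦ p (k + 1)) n)).2).argInc z = _
    have h0 : z ∉ range (Path.segment (p 0) (p 1)) := by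
      rw [Path.range_segment]; exact hz 0 (Nat.succ_pos n)
    have h1 : z ∉ range (polylineFrom (p 1) (ptsList (fun k ↦ p (k + 1)) n)).2 := by
      intro h
      rcases mem_segment_of_mem_range_polylineFrom_ptsList (fun k ↦ p (k + 1)) n h with h | ⟨k, hk, h⟩
      · exact hz 0 (Nat.succ_pos n) (h ▸ right_mem_segment _ _ _)
      · exact hz (k + 1) (by omega) h
    rw [Path.argInc_trans _ _ h0 h1,
      argInc_polylineFrom_ptsList (fun k ↦ p (k + 1)) n fun k hk ↦ hz (k + 1) (by omega),
      Finset.sum_range_succ' _ n, add_comm]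

/-- The same for the stretches `polySubPath δ w i₀ k` of the polygon of a walk of `H` (the other
dyadic bracketing, by `Path.trans` on the left). -/
theorem argInc_polySubPath {f₀ g₀ : HexVertex} (δ : ℝ) (w : hexGraph.Walk f₀ g₀) (i₀ : ℕ) :
    ∀ (k : ℕ) {z : ℂ}, (∀ j ≤ k, z ∉ polyPiece δ w (i₀ + j)) →
      (polySubPath δ w i₀ k).argInc z =
        ∑ j ∈ Finset.range (k + 1),
          (Path.segment (polyPt δ w (i₀ + j)) (polyPt δ w (i₀ + j + 1))).argInc z
  | 0, z, _ => by rw [polySubPath]; simp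
  | k + 1, z, hz => by
    have hrange : z ∉ range (polySubPath δ w i₀ k) := by
      intro h
      obtain ⟨j, hj, hzj⟩ := mem_iUnion₂.1 (range_polySubPath_subset i₀ k h)
      exact hz j (by omega) hzj
    have hlast : z ∉ range (Path.segment (polyPt δ w (i₀ + k + 1)) (polyPt δ w (i₀ + k + 1 + 1))) := by
      rw [Path.range_segment]; exact hz (k + 1) le_rfl
    rw [polySubPath, Path.argInc_trans _ _ hrange hlast,
      argInc_polySubPath δ w i₀ k fun j hj ↦ hz j (by omega), Finset.sum_range_succ _ (k + 1)]
    rfl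

variable {f₀ : HexVertex}

/-- The polygon of a closed walk ends at the rescaled centre of its base face. -/
theorem hexLoopCurve_one (δ : ℝ) (w : hexGraph.Walk f₀ f₀) :
    hexLoopCurve δ w 1 = (δ : ℂ) * hexCenter f₀ := by
  change (w.toCurve fun v ↦ (δ : ℂ) * hexCenter v) 1 = _
  cases w with
  | nil => simp [SimpleGraph.Walk.toCurve, polyline_apply_one]
  | cons h p => simp [SimpleGraph.Walk.toCurve, polyline_apply_one, List.getLast_map]

/-- The polygon of a closed walk starts at the rescaled centre of its base face. -/
theorem hexLoopCurve_zero (δ : ℝ) (w : hexGraph.Walk f₀ f₀) :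
    hexLoopCurve δ w 0 = (δ : ℂ) * hexCenter f₀ :=
  SimpleGraph.Walk.toCurve_apply_zero _ _

/-- **Off the trace, the winding number of the drawn loop `hexLoopCurve δ w` (dyadic polyline with
constant tail) equals `loopWind δ w`** (the left-bracketed stretch `loopPath`): both are
`(2πi)⁻¹` times the sum of the argument increments of the dart pieces. -/
theorem loopWind_eq_wind_hexLoopCurve {δ : ℝ} {w : hexGraph.Walk f₀ f₀} (hlen : 0 < w.length)
    {z : ℂ} (hz : z ∉ polyTrace δ w) : loopWind δ w z = (hexLoopCurve δ w).wind z := by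
  have hpiece : ∀ i < w.length, z ∉ polyPiece δ w i := fun i hi h ↦
    hz (polyPiece_subset_polyTrace hi h)
  set S := ∑ k ∈ Finset.range w.length,
    (Path.segment (polyPt δ w k) (polyPt δ w (k + 1))).argInc z with hS
  -- the stretch `loopPath`
  have hA : (loopPath δ w).argInc z = S := by
    have h := argInc_polySubPath δ w 0 (w.length - 1) (z := z)
      (fun j hj ↦ by rw [Nat.zero_add]; exact hpiece j (by omega))
    rw [Nat.sub_add_cancel hlen] at h
    rw [hS, loopPath, h]
    exact Finset.sum_congr rfl fun x _ ↦ by rw [Nat.zero_add]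
  have hA' := argInc_eq_wind_mul_of_eq (loopPath δ w) (polyPt_length_pred_succ hlen) (p := z)
    (by rw [range_loopPath hlen]; exact hz)
  -- the dyadic polyline `toCurve`
  set B := (polylineFrom (polyPt δ w 0) (ptsList (polyPt δ w) w.length)).2 with hB
  have hBapply : ∀ u, hexLoopCurve δ w u = B u := fun u ↦ toCurve_eq_polylineFrom_ptsList w u
  have hB1 : (polylineFrom (polyPt δ w 0) (ptsList (polyPt δ w) w.length)).1 = polyPt δ w 0 := by
    rw [← B.target, ← hBapply, hexLoopCurve_one, polyPt, SimpleGraph.Walk.getVert_zero]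
  have hBrange : z ∉ range B := by
    intro h
    rcases mem_segment_of_mem_range_polylineFrom_ptsList (polyPt δ w) w.length h with h | ⟨k, hk, h⟩
    · exact hpiece 0 hlen (h ▸ left_mem_segment _ _ _)
    · exact hpiece k hk h
  have hBS : B.argInc z = S := argInc_polylineFrom_ptsList (polyPt δ w) w.length hpiece
  have hB' := argInc_eq_wind_mul_of_eq B hB1 hBrange
  have hsub : (hexLoopCurve δ w).subPt z = fun t ↦ B.extend t - z := by
    funext t
    change hexLoopCurve δ w (projIcc 0 1 zero_le_one t) - z = B (projIcc 0 1 zero_le_one t) - z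
    rw [hBapply]
  have key : ((loopWind δ w z : ℤ) : ℂ) * (2 * π * Complex.I) =
      ((hexLoopCurve δ w).wind z : ℂ) * (2 * π * Complex.I) := by
    rw [Curve.wind, hsub, loopWind, ← hA', ← hB', hA, hBS]
  exact int_eq_of_mul_two_pi_I_eq key

/-- **`W(siteLoopCurve δ w, z) = loopWind δ w z` off the trace.** -/
theorem wind_siteLoopCurve_eq_loopWind {δ : ℝ} {w : hexGraph.Walk f₀ f₀} (hlen : 0 < w.length)
    {z : ℂ} (hz : z ∉ polyTrace δ w) : (siteLoopCurve δ w).wind z = loopWind δ w z :=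
  (loopWind_eq_wind_hexLoopCurve hlen hz).symm

end ArgInc

/-! ## §2 Scale invariance of the winding numbers -/

section Scaling

variable {f₀ g₀ : HexVertex}

/-- The polygon at mesh `δ` is the polygon at mesh `1` scaled by `δ`. -/
theorem hexLoopCurve_eq_map (δ : ℝ) (w : hexGraph.Walk f₀ g₀) :
    hexLoopCurve δ w = (hexLoopCurve 1 w).map ⟨fun z ↦ (δ : ℂ) * z + 0, by fun_prop⟩ := by
  apply Curve.ext
  ext u
  change (w.toCurve fun v ↦ (δ : ℂ) * hexCenter v) u = (δ : ℂ) * (w.toCurve fun v ↦ (1 : ℂ) * hexCenter v) u + 0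
  simp only [SimpleGraph.Walk.toCurve, add_zero]
  have hl : w.support.map ((fun z : ℂ ↦ (δ : ℂ) * z) ∘ fun v ↦ (1 : ℂ) * hexCenter v) =
      w.support.map fun v ↦ (δ : ℂ) * hexCenter v :=
    List.map_congr_left fun v _ ↦ by simp
  rw [apply_polyline (fun z : ℂ ↦ (δ : ℂ) * z) (mul_zero _)
    (fun x y c ↦ by simp only [AffineMap.lineMap_apply_module', Complex.real_smul]; ring),
    List.map_map, hl]

/-- **Scale invariance**: `W(hexLoopCurve δ w, δ z) = W(hexLoopCurve 1 w, z)` for `δ ≠ 0`. -/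
theorem wind_hexLoopCurve_mul {δ : ℝ} (hδ : δ ≠ 0) (w : hexGraph.Walk f₀ g₀) (z : ℂ) :
    (hexLoopCurve δ w).wind ((δ : ℂ) * z) = (hexLoopCurve 1 w).wind z := by
  have h := Curve.wind_map_affine (hexLoopCurve 1 w) (Complex.ofReal_ne_zero.2 hδ) 0 z
  rw [add_zero, ← hexLoopCurve_eq_map] at h
  exact h

/-- **The winding number about a site does not depend on the mesh**:
`W(siteLoopCurve δ w, triMeshPoint δ x) = W(siteLoopCurve 1 w, triMeshPoint 1 x)`. -/
theorem wind_siteLoopCurve_triMeshPoint {δ : ℝ} (hδ : δ ≠ 0) (w : hexGraph.Walk f₀ f₀) (x : Site 2) :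
    (siteLoopCurve δ w).wind (triMeshPoint δ x) = (siteLoopCurve 1 w).wind (triMeshPoint 1 x) := by
  change (hexLoopCurve δ w).wind _ = (hexLoopCurve 1 w).wind _
  rw [triMeshPoint, triMeshPoint, Complex.ofReal_one, one_mul, wind_hexLoopCurve_mul hδ]

end Scaling

/-! ## §3 The polygon of a cycle of `H` as a Jordan loop -/

section Jordan

variable {f₀ : HexVertex}

/-- `tailStart n > 0` for `n ≥ 1`. -/
theorem tailStart_pos {n : ℕ} (hn : 0 < n) : 0 < tailStart n := by
  have : (1 / 2 : ℝ) ^ n < 1 := pow_lt_one₀ (by norm_num) (by norm_num) hn.ne'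
  simp only [tailStart]; linarith

/-- On the constant tail the polygon sits at its base point. -/
theorem hexLoopCurve_eq_zero_of_tailStart_le (δ : ℝ) (w : hexGraph.Walk f₀ f₀) {u : unitInterval}
    (hu : tailStart w.length ≤ (u : ℝ)) : hexLoopCurve δ w u = hexLoopCurve δ w 0 := by
  rw [loopCurve_apply, toCurve_eq_toCurve_one_of_tailStart_le w hu, ← loopCurve_apply,
    hexLoopCurve_one, hexLoopCurve_zero]

/-- The same for the extension to `ℝ`. -/
theorem iccExtend_hexLoopCurve_of_tailStart_le (δ : ℝ) (w : hexGraph.Walk f₀ f₀) {s : ℝ}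
    (hs : tailStart w.length ≤ s) :
    IccExtend zero_le_one (hexLoopCurve δ w) s = hexLoopCurve δ w 0 := by
  rw [IccExtend_apply]
  refine hexLoopCurve_eq_zero_of_tailStart_le δ w ?_
  change tailStart w.length ≤ max 0 (min 1 s)
  have := tailStart_lt_one w.length
  exact le_max_of_le_right (le_min this.le hs)

/-- **The Jordan parametrisation `JL⟦δ, w⟧` of the polygon of a closed walk of `H`**: the dyadic
polyline `hexLoopCurve δ w` run over the times `[0, 1 - 2^{-n}]` before its constant tail, sped up to
unit period, `1`-periodically (a local notation, unfolded in all statements). -/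
local notation3 "JL⟦" δ ", " w "⟧" =>
  (fun t : ℝ ↦ IccExtend zero_le_one (⇑(hexLoopCurve δ w)) (tailStart (SimpleGraph.Walk.length w) * Int.fract t))

/-- Values of the Jordan parametrisation lie on the polygon. -/
theorem hexJordanLoop_mem_range (δ : ℝ) (w : hexGraph.Walk f₀ f₀) (t : ℝ) :
    JL⟦δ, w⟧ t ∈ (hexLoopCurve δ w).range := by
  rw [Curve.range, ← IccExtend_range zero_le_one (hexLoopCurve δ w)]
  exact mem_range_self _

/-- At integer times the Jordan parametrisation is at the base point. -/
theorem hexJordanLoop_zero (δ : ℝ) (w : hexGraph.Walk f₀ f₀) : JL⟦δ, w⟧ 0 = hexLoopCurve δ w 0 := by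
  simp

/-- The Jordan parametrisation is `1`-periodic. -/
theorem periodic_hexJordanLoop (δ : ℝ) (w : hexGraph.Walk f₀ f₀) :
    Function.Periodic (JL⟦δ, w⟧) 1 := fun t ↦ by
  simp

/-- The Jordan parametrisation is continuous (the polygon is back at its base point when the tail
starts). -/
theorem continuous_hexJordanLoop (δ : ℝ) (w : hexGraph.Walk f₀ f₀) : Continuous (JL⟦δ, w⟧) := by
  have hF : Continuous (IccExtend zero_le_one (hexLoopCurve δ w)) :=
    (hexLoopCurve δ w).continuous.Icc_extend'
  have h := ContinuousOn.comp_fract'' (f := fun s : ℝ ↦ IccExtend zero_le_one (hexLoopCurve δ w)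
    (tailStart w.length * s)) ((hF.comp (continuous_const.mul continuous_id)).continuousOn) (by
      simp only [mul_zero, mul_one, IccExtend_of_mem _ _ (left_mem_Icc.2 (zero_le_one' ℝ))]
      rw [iccExtend_hexLoopCurve_of_tailStart_le δ w le_rfl]
      rfl)
  exact h

/-- On the period `[0, 1)` the Jordan parametrisation is the polygon at the rescaled time. -/
theorem hexJordanLoop_of_mem_Ico (δ : ℝ) (w : hexGraph.Walk f₀ f₀) {t : ℝ} (ht : t ∈ Ico (0 : ℝ) 1) :
    JL⟦δ, w⟧ t = hexLoopCurve δ w ⟨tailStart w.length * t,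
      ⟨mul_nonneg (tailStart_nonneg _) ht.1,
        (mul_le_one₀ (tailStart_lt_one _).le ht.1 ht.2.le)⟩⟩ := by
  show IccExtend zero_le_one (hexLoopCurve δ w) (tailStart w.length * Int.fract t) = _
  rw [Int.fract_eq_self.2 ⟨ht.1, ht.2⟩, IccExtend_of_mem]

/-- **The Jordan parametrisation of a cycle is injective on a period** (`toCurve_eq_toCurve_of_isCycle`). -/
theorem injOn_hexJordanLoop {δ : ℝ} (hδ : δ ≠ 0) {w : hexGraph.Walk f₀ f₀} (hw : w.IsCycle) :
    InjOn (JL⟦δ, w⟧) (Ico 0 1) := by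
  have hc := tailStart_pos (show 0 < w.length by have := hw.three_le_length; omega)
  intro s hs t ht hst
  rw [hexJordanLoop_of_mem_Ico δ w hs, hexJordanLoop_of_mem_Ico δ w ht] at hst
  by_contra hne
  have key : ∀ {a b : ℝ} (ha : a ∈ Ico (0 : ℝ) 1) (hb : b ∈ Ico (0 : ℝ) 1), a < b →
      hexLoopCurve δ w ⟨tailStart w.length * a, ⟨mul_nonneg (tailStart_nonneg _) ha.1,
        (mul_le_one₀ (tailStart_lt_one _).le ha.1 ha.2.le)⟩⟩ ≠
      hexLoopCurve δ w ⟨tailStart w.length * b, ⟨mul_nonneg (tailStart_nonneg _) hb.1,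
        (mul_le_one₀ (tailStart_lt_one _).le hb.1 hb.2.le)⟩⟩ := by
    intro a b ha hb hab heq
    have hlt : (⟨tailStart w.length * a, ⟨mul_nonneg (tailStart_nonneg _) ha.1,
        (mul_le_one₀ (tailStart_lt_one _).le ha.1 ha.2.le)⟩⟩ : unitInterval) <
        ⟨tailStart w.length * b, ⟨mul_nonneg (tailStart_nonneg _) hb.1,
        (mul_le_one₀ (tailStart_lt_one _).le hb.1 hb.2.le)⟩⟩ :=
      Subtype.mk_lt_mk.2 (mul_lt_mul_of_pos_left hab hc)
    rcases toCurve_eq_toCurve_of_isCycle hδ hw hlt heq with h | ⟨-, h⟩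
    · change tailStart w.length ≤ tailStart w.length * a at h
      nlinarith [ha.2]
    · change tailStart w.length ≤ tailStart w.length * b at h
      nlinarith [hb.2]
  rcases lt_or_gt_of_ne hne with h | h
  · exact key hs ht h hst
  · exact key ht hs h hst.symm

/-- **The polygon of a cycle of `H` at mesh `δ ≠ 0` is a Jordan curve.** -/
theorem isJordanLoop_hexJordanLoop {δ : ℝ} (hδ : δ ≠ 0) {w : hexGraph.Walk f₀ f₀} (hw : w.IsCycle) :
    IsJordanLoop (JL⟦δ, w⟧) :=
  ⟨continuous_hexJordanLoop δ w, periodic_hexJordanLoop δ w, injOn_hexJordanLoop hδ hw⟩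

/-- **The Jordan parametrisation has the trace of the polygon** (for a walk with a dart). -/
theorem range_hexJordanLoop (δ : ℝ) {w : hexGraph.Walk f₀ f₀} (hlen : 0 < w.length) :
    range (JL⟦δ, w⟧) = (hexLoopCurve δ w).range := by
  refine Subset.antisymm (range_subset_iff.2 (hexJordanLoop_mem_range δ w)) ?_
  rintro _ ⟨u, rfl⟩
  have hc := tailStart_pos hlen
  by_cases hu : (u : ℝ) < tailStart w.length
  · have ht : (u : ℝ) / tailStart w.length ∈ Ico (0 : ℝ) 1 :=
      ⟨div_nonneg u.2.1 hc.le, (div_lt_one hc).2 hu⟩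
    refine ⟨(u : ℝ) / tailStart w.length, ?_⟩
    rw [hexJordanLoop_of_mem_Ico δ w ht]
    congr 1
    exact Subtype.ext (mul_div_cancel₀ _ hc.ne')
  · refine ⟨0, ?_⟩
    rw [hexJordanLoop_zero, hexLoopCurve_eq_zero_of_tailStart_le δ w (not_lt.1 hu)]

/-- **The Jordan parametrisation winds like the drawn loop**: `wind (JL⟦δ, w⟧ − z) =
W(hexLoopCurve δ w, z)` off the trace (free homotopy through the time rescalings
`t ↦ ((1 - s) + s (1 - 2^{-n})) t`, all running along the trace, `wind_eq_of_homotopy`). -/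
theorem wind_hexJordanLoop_sub (δ : ℝ) (w : hexGraph.Walk f₀ f₀) {z : ℂ}
    (hz : z ∉ (hexLoopCurve δ w).range) :
    wind (fun t ↦ JL⟦δ, w⟧ t - z) = (hexLoopCurve δ w).wind z := by
  set F : ℝ → ℂ := IccExtend zero_le_one (hexLoopCurve δ w) with hF
  set c : ℝ := tailStart w.length with hc
  have hc1 : c ≤ 1 := (tailStart_lt_one _).le
  have hFc : F = (hexLoopCurve δ w).subPt z + fun _ ↦ z := by
    funext t; simp [hF, Curve.subPt]
  have hFcont : Continuous F := (hexLoopCurve δ w).continuous.Icc_extend'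
  have hFmem : ∀ s, F s ≠ z := fun s h ↦ hz (by
    rw [Curve.range, ← IccExtend_range zero_le_one (hexLoopCurve δ w), ← h]; exact mem_range_self _)
  have hFtail : ∀ s, c ≤ s → F s = F 0 := fun s hs ↦ by
    rw [hF, iccExtend_hexLoopCurve_of_tailStart_le δ w hs, IccExtend_of_mem _ _ (left_mem_Icc.2 zero_le_one)]
    rfl
  -- the homotopy
  set H : ℝ → ℝ → ℂ := fun s t ↦ F (((1 - s) + s * c) * t) - z with hH
  have hcont : ContinuousOn (Function.uncurry H) (Icc 0 1 ×ˢ Icc 0 1) := by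
    refine Continuous.continuousOn ?_
    simp only [hH, Function.uncurry_def]
    fun_prop
  have hloop : ∀ s ∈ Icc (0 : ℝ) 1, H s 0 = H s 1 := by
    intro s hs
    simp only [hH, mul_zero, mul_one]
    rw [hFtail ((1 - s) + s * c) (by nlinarith [hs.1, hs.2])]
  have hne : ∀ s ∈ Icc (0 : ℝ) 1, ∀ t ∈ Icc (0 : ℝ) 1, H s t ≠ 0 := fun s _ t _ ↦
    sub_ne_zero.2 (hFmem _)
  have hhom := Literature.Topology.PlaneTopology.wind_eq_of_homotopy hcont hloop hne
  -- identify the two ends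
  have h0 : H 0 = (hexLoopCurve δ w).subPt z := by
    funext t; simp [hH, hF, Curve.subPt]
  have h1 : EqOn (fun t ↦ JL⟦δ, w⟧ t - z) (H 1) (Icc 0 1) := by
    intro t ht
    simp only [hH, sub_self, zero_add, one_mul]
    show F (c * Int.fract t) - z = F (c * t) - z
    rcases eq_or_lt_of_le ht.2 with rfl | hlt
    · rw [mul_one, hFtail c le_rfl, Int.fract_one, mul_zero]
    · rw [Int.fract_eq_self.2 ⟨ht.1, hlt⟩]
  rw [wind_congr h1, ← hhom, h0, Curve.wind]

/-- **The inside of the Jordan loop of a cycle is the winding interior of the drawn loop**: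
`inside JL⟦δ, w⟧ = {z | W(siteLoopCurve δ w, z) ≠ 0}` (Jordan curve theorem,
`IsJordanLoop.mem_inside_iff_wind_ne_zero`; on the trace both sides exclude `z`). -/
theorem inside_hexJordanLoop_eq {δ : ℝ} (hδ : δ ≠ 0) {w : hexGraph.Walk f₀ f₀} (hw : w.IsCycle) :
    IsJordanLoop.inside (JL⟦δ, w⟧) = {z | (siteLoopCurve δ w).wind z ≠ 0} := by
  have hlen : 0 < w.length := by have := hw.three_le_length; omega
  have hJ := isJordanLoop_hexJordanLoop hδ hw
  ext z
  change _ ↔ (hexLoopCurve δ w).wind z ≠ 0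
  by_cases hz : z ∈ (hexLoopCurve δ w).range
  · rw [Curve.wind_of_mem_range hz]
    simp only [ne_eq, not_true_eq_false, iff_false]
    exact fun h ↦ h.1 (by rw [range_hexJordanLoop δ hlen]; exact hz)
  · rw [hJ.mem_inside_iff_wind_ne_zero (by rw [range_hexJordanLoop δ hlen]; exact hz),
      wind_hexJordanLoop_sub δ w hz]

/-! ## §4 Interiors of two interface loops of one configuration are nested or disjoint -/

/-- **Interior trichotomy.**  For two interface loops `w`, `w'` of the SAME site configuration `ω`
and a mesh `δ > 0`, the winding interiors `{W ≠ 0}` of the drawn loops `siteLoopCurve δ w`,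
`siteLoopCurve δ w'` are nested or disjoint: the traces are equal (then so are the interiors, which
only depend on the trace) or disjoint (`IsSiteInterfaceLoop.polyTrace_eq_or_disjoint`), and two
disjoint Jordan curves are nested or mutually exterior (`IsJordanLoop.trichotomy`). -/
theorem interior_trichotomy : ∀ {ω : SiteConfig (Site 2)} {f₀ f₁ : HexVertex} {w : hexGraph.Walk f₀ f₀} {w' : hexGraph.Walk f₁ f₁}, IsSiteInterfaceLoop ω w → IsSiteInterfaceLoop ω w' → ∀ {δ : ℝ}, 0 < δ → {z | (siteLoopCurve δ w').wind z ≠ 0} ⊆ {z | (siteLoopCurve δ w).wind z ≠ 0} ∨ {z | (siteLoopCurve δ w).wind z ≠ 0} ⊆ {z | (siteLoopCurve δ w').wind z ≠ 0} ∨ Disjoint {z | (siteLoopCurve δ w).wind z ≠ 0} {z | (siteLoopCurve δ w').wind z ≠ 0} := by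
  intro ω f₀ f₁ w w' hw hw' δ hδ
  have hlen : 0 < w.length := by have := hw.isCycle.three_le_length; omega
  have hlen' : 0 < w'.length := by have := hw'.isCycle.three_le_length; omega
  have hJ := isJordanLoop_hexJordanLoop hδ.ne' hw.isCycle
  have hJ' := isJordanLoop_hexJordanLoop hδ.ne' hw'.isCycle
  rw [← inside_hexJordanLoop_eq hδ.ne' hw.isCycle, ← inside_hexJordanLoop_eq hδ.ne' hw'.isCycle]
  have hr : range (JL⟦δ, w⟧) = polyTrace δ w := by
    rw [range_hexJordanLoop δ hlen, Curve.range]; exact range_toCurve_eq_polyTrace hlen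
  have hr' : range (JL⟦δ, w'⟧) = polyTrace δ w' := by
    rw [range_hexJordanLoop δ hlen', Curve.range]; exact range_toCurve_eq_polyTrace hlen'
  rcases hw.polyTrace_eq_or_disjoint hδ.ne' hw' with heq | hdis
  · refine Or.inl (Eq.subset ?_)
    simp only [IsJordanLoop.inside, hr, hr', heq]
  · have hdis' : Disjoint (range (JL⟦δ, w⟧)) (range (JL⟦δ, w'⟧)) := by
      rwa [hr, hr']
    rcases IsJordanLoop.trichotomy hJ hJ' hdis' with h | h | ⟨h, h'⟩
    · exact Or.inr (Or.inl (IsJordanLoop.inside_subset_inside hJ hJ' h))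
    · exact Or.inl (IsJordanLoop.inside_subset_inside hJ' hJ h)
    · exact Or.inr (Or.inr (IsJordanLoop.disjoint_inside_inside hJ hJ' h h'))

end Jordan

end Summit.CriticalPhenomena.CardyFormulaZ2.Cruxes.NestingRigidity.MarkovCascadeOneGeneration

end
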